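import Mathlib
import HarnessLib
import Summits.HubbardSuperconductivity.HubbardSuperconductivity.Theorems.KLProgrammeKLRegimeFlowReadScaleZeroChainSplit
import Literature.MathematicalPhysics.QuantumLattice.HubbardUVSymbolSmooth

/-!
# Route `KLProgramme`, crux K3 — gen-8 ENGINE-FLOW child (stmt-HubbardSuperconductivity-20437 `KLRegimeEngineV17F2`), stub (C) at `n = 0`,
# located item #22a «(C)-SCALE0-PT2», step (π2c-i): the Hartree chain's LOCALISED SYMBOL is a function of the band energy `e(k⃗) = ε(k⃗) − μ` ALONE,
# given by the continuum UV symbol `uvSymbolFn`, and that function VANISHES at `e = 0` — so the chain is ZERO on the free Fermi curve before interpolation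

Seat hubbard-kl-k3c5-p1 (g13; owner of #22a).  From π2b (`selfEnergy_map_gridSub_chainQuadratic`, p613532): the momentum self-energy of the chain
quadratic `Q_c` is `−c·((4M)²/(β³L²))·Ψ⁰(K,σ)`, and `Ψ⁰((i,k⃗),σ) = uvSymbolFn (βL²) klE0 (e(k⃗)) (ω_i)` (`uvSymbolCT_eq_uvSymbolFn`).  Hence the symbol the
MIXED door (p608958) interpolates for `W_b := Q_c`, `loc(X)(k⃗) = ¼Σ_σ[Re Σ_X((ω₀,k⃗),σ) + Re Σ_X((−ω₀,k⃗),σ)]`, is `G_c(e(k⃗))` with the explicit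
`G_c(e) = ½·[Re(−c(4M)²/(β³L²)·Ψ̂(e, π/β)) + Re(−c(4M)²/(β³L²)·Ψ̂(e, −π/β))]` — and `Ψ̂(0,ω) + Ψ̂(0,−ω) = 0` (the resolvent `c/(−iω)` is odd, the weight
`χ₂(ω²/Λ²)` even), so `G_c(0) = 0`: on the free Fermi curve `{e = 0}` the chain's continuum symbol is IDENTICALLY ZERO, and its interpolant's reading
`H∘γ₀` is pure `I_L`-aliasing (π2c-ii).

* `uvSymbolFn_zero_band_add_neg_freq` — `Ψ̂(0,ω) + Ψ̂(0,−ω) = 0`;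
* **`locSymbol_map_gridSub_chainQuadratic`** — the localised symbol of `map S_{4M} Q_c` equals `G_c ∘ (nambuXi L μ)` (`0 < β`);
* **`chainCurveFn_zero`** — `G_c(0) = 0`; `locSymbol_map_gridSub_chainQuadratic_eq_zero_of_nambuXi_eq_zero` — the symbol vanishes at every lattice
  momentum ON the free curve.

Proofs only; no definitions (the function `G_c` is written out); nothing asserts any stub of 20437, K3 or superconductivity.
References: BGM 2006 §2.1 (2.3) [cite: BenfattoGiulianiMastropietro2006]; Salmhofer 1999 §4.2.5 (4.70) [cite: Salmhofer1999].
-/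

noncomputable section

namespace Summit.HubbardSuperconductivity.HubbardSuperconductivity.Theorems.KLRegimeSplit

set_option linter.dupNamespace false -- summit = problem name (single-conjunct summit), D-0017

open Literature.MathematicalPhysics.QuantumLattice Literature.Probability.LatticeModels GrassmannAlgebra Finset Matrix Complex
open Summit.HubbardSuperconductivity.HubbardSuperconductivity.Theorems.EngineV8

/-! ## §1 The UV symbol at zero band energy is odd in the frequency -/

/-- **`Ψ̂(0,ω) + Ψ̂(0,−ω) = 0`**: at `e = 0` the resolvent `c/(−iω)` is odd in `ω` and the weight `χ₂(ω²/Λ²)` even. -/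
theorem uvSymbolFn_zero_band_add_neg_freq (c Λ ω : ℝ) : uvSymbolFn c Λ 0 ω + uvSymbolFn c Λ 0 (-ω) = 0 := by
  have hw : uvWeightFn Λ 0 (-ω) = uvWeightFn Λ 0 ω := by simp [uvWeightFn]
  rw [uvSymbolFn, uvSymbolFn, hw, resolventFn, resolventFn]
  push_cast
  simp only [add_zero]
  rcases eq_or_ne ω 0 with hω | hω
  · subst hω; simp
  · have hI : (-I * (ω : ℂ)) ≠ 0 := by
      refine mul_ne_zero (neg_ne_zero.2 I_ne_zero) ?_
      exact_mod_cast hω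
    field_simp
    ring

/-! ## §2 The chain's localised symbol is a function of the band energy -/

variable {L M : ℕ} [NeZero L] [NeZero M]

/-- **THE LOCALISED SYMBOL OF THE CHAIN IS `G_c ∘ e`** (`0 < β`): for the chain quadratic `Q_c` of π2b,
`¼Σ_σ[Re Σ[map S Q_c]((ω₀,k⃗),σ) + Re Σ[map S Q_c]((−ω₀,k⃗),σ)] = ½[Re(−c(4M)²/(β³L²)·Ψ̂(e(k⃗),π/β)) + Re(−c(4M)²/(β³L²)·Ψ̂(e(k⃗),−π/β))]`, `e = nambuXi L μ`. -/
theorem locSymbol_map_gridSub_chainQuadratic {β : ℝ} (hβ : 0 < β) (μ : ℝ) (c : ℂ) (k : TorusSite 2 L) :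
    (∑ σ : Fin 2, ((selfEnergy L M β (ExteriorAlgebra.map (Matrix.toLin' (hubbardGridSub L M β (2 * (2 * M))))
        (∑ p : GridPoint L (2 * (2 * M)), ∑ q : GridPoint L (2 * (2 * M)), ∑ σ' : Fin 2,
          (c * contr ℂ ((hubbardGridSub L M β (2 * (2 * M))).transpose * hubbardCovAboveCT L M β μ 0 0 klE0 *
              hubbardGridSub L M β (2 * (2 * M))) (((q, σ'), 0) : GridLeg (GridPoint L (2 * (2 * M)))) ((p, σ'), 1)) •
            (gen ℂ (((p, σ'), 0) : GridLeg (GridPoint L (2 * (2 * M)))) * gen ℂ (((q, σ'), 1) : GridLeg (GridPoint L (2 * (2 * M)))))))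
          (omega0 M, k) σ).re +
      (selfEnergy L M β (ExteriorAlgebra.map (Matrix.toLin' (hubbardGridSub L M β (2 * (2 * M))))
        (∑ p : GridPoint L (2 * (2 * M)), ∑ q : GridPoint L (2 * (2 * M)), ∑ σ' : Fin 2,
          (c * contr ℂ ((hubbardGridSub L M β (2 * (2 * M))).transpose * hubbardCovAboveCT L M β μ 0 0 klE0 *
              hubbardGridSub L M β (2 * (2 * M))) (((q, σ'), 0) : GridLeg (GridPoint L (2 * (2 * M)))) ((p, σ'), 1)) •
            (gen ℂ (((p, σ'), 0) : GridLeg (GridPoint L (2 * (2 * M)))) * gen ℂ (((q, σ'), 1) : GridLeg (GridPoint L (2 * (2 * M)))))))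
          ((omega0 M).rev, k) σ).re)) / 4 =
      ((-c * ((((2 * (2 * M) : ℕ) : ℂ) ^ 2 / (β ^ 3 * (L : ℝ) ^ 2 : ℝ)) : ℂ) *
          uvSymbolFn (β * (L : ℝ) ^ 2) klE0 (nambuXi L μ k) (Real.pi / β)).re +
        (-c * ((((2 * (2 * M) : ℕ) : ℂ) ^ 2 / (β ^ 3 * (L : ℝ) ^ 2 : ℝ)) : ℂ) *
          uvSymbolFn (β * (L : ℝ) ^ 2) klE0 (nambuXi L μ k) (-(Real.pi / β))).re) / 2 := by
  simp only [selfEnergy_map_gridSub_chainQuadratic hβ.ne' μ c, uvSymbolCT_eq_uvSymbolFn hβ, nambuXiCT_zero_frame, matsubaraFreq_omega0,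
    matsubaraFreq_omega0_rev, Finset.sum_const, Finset.card_univ, Fintype.card_fin, nsmul_eq_mul, Nat.cast_ofNat]
  ring

/-! ## §3 The chain's symbol vanishes on the free Fermi curve -/

/-- **`G_c(0) = 0`**: at zero band energy the two frequencies cancel, whatever the (complex) coefficient. -/
theorem chainCurveFn_zero (κ : ℂ) (cc Λ β : ℝ) :
    ((κ * uvSymbolFn cc Λ 0 (Real.pi / β)).re + (κ * uvSymbolFn cc Λ 0 (-(Real.pi / β))).re) / 2 = 0 := by
  rw [← Complex.add_re, ← mul_add, uvSymbolFn_zero_band_add_neg_freq, mul_zero, Complex.zero_re, zero_div]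

/-- **ON THE FREE FERMI CURVE THE CHAIN'S LOCALISED SYMBOL IS ZERO**: at every lattice momentum `k⃗` with `e(k⃗) = nambuXi L μ k⃗ = 0`. -/
theorem locSymbol_map_gridSub_chainQuadratic_eq_zero_of_nambuXi_eq_zero {β : ℝ} (hβ : 0 < β) (μ : ℝ) (c : ℂ) (k : TorusSite 2 L)
    (hk : nambuXi L μ k = 0) :
    (∑ σ : Fin 2, ((selfEnergy L M β (ExteriorAlgebra.map (Matrix.toLin' (hubbardGridSub L M β (2 * (2 * M))))
        (∑ p : GridPoint L (2 * (2 * M)), ∑ q : GridPoint L (2 * (2 * M)), ∑ σ' : Fin 2,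
          (c * contr ℂ ((hubbardGridSub L M β (2 * (2 * M))).transpose * hubbardCovAboveCT L M β μ 0 0 klE0 *
              hubbardGridSub L M β (2 * (2 * M))) (((q, σ'), 0) : GridLeg (GridPoint L (2 * (2 * M)))) ((p, σ'), 1)) •
            (gen ℂ (((p, σ'), 0) : GridLeg (GridPoint L (2 * (2 * M)))) * gen ℂ (((q, σ'), 1) : GridLeg (GridPoint L (2 * (2 * M)))))))
          (omega0 M, k) σ).re +
      (selfEnergy L M β (ExteriorAlgebra.map (Matrix.toLin' (hubbardGridSub L M β (2 * (2 * M))))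
        (∑ p : GridPoint L (2 * (2 * M)), ∑ q : GridPoint L (2 * (2 * M)), ∑ σ' : Fin 2,
          (c * contr ℂ ((hubbardGridSub L M β (2 * (2 * M))).transpose * hubbardCovAboveCT L M β μ 0 0 klE0 *
              hubbardGridSub L M β (2 * (2 * M))) (((q, σ'), 0) : GridLeg (GridPoint L (2 * (2 * M)))) ((p, σ'), 1)) •
            (gen ℂ (((p, σ'), 0) : GridLeg (GridPoint L (2 * (2 * M)))) * gen ℂ (((q, σ'), 1) : GridLeg (GridPoint L (2 * (2 * M)))))))
          ((omega0 M).rev, k) σ).re)) / 4 = 0 := by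
  rw [locSymbol_map_gridSub_chainQuadratic hβ μ c k, hk]
  exact chainCurveFn_zero _ _ _ _

end Summit.HubbardSuperconductivity.HubbardSuperconductivity.Theorems.KLRegimeSplit

end
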